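/-
Copyright (c) 2026 the pub-hodgecm2 formalisation cell (harness21).  New file, not vendored.
Origin: seat `prover-pub-hodgecm2-rekey-l0-instlevel-a-g1-0` (unit pub-hodgecm2-rekey-l0-instlevel-a-g1), door T of DECISION #19
(pub-hodgecm2/INBOX 2026-08-23): wb-10's conjugate-transposed-pin transport heads with the `res`-law on FIXED vectors, 2026-08-23.
HELD pending orientation adjudication; HC_CM is NOT proved; nothing here is cited anew, no definition, no named fact.
-/
import Summits.HodgeConjecture.CorCM.D2Bridge.LevelConjAlong
import Summits.HodgeConjecture.CorCM.D2Bridge.Thm418CTransportFixed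
import HarnessLib

/-!
# Door T (`(V, ι₁) ↦ (V.transposeAt ι₀ h, ι₀)`) with the `res`-law on FIXED vectors only

`D2Bridge/LevelConjAlong` (wb-10) §L2 `thm418C_transposeAt_iff_of_transport` and §L3 `thm418C_pin_transposeAt_iff_of_transport` take the
law `hres : ∀ K x, cohCCast … (T₁.res K x) = T₂.res (levelConjAlong K ι₀ h) (eH x)` for ALL `x : T₁.H`.  For the model's dictionaries
(`res K = TowerCarrier.resTotal K`, a CHOSEN linear extension off the `K.K`-fixed vectors, `Model/TowerRes`) only the restriction of that
law to `x ∈ fixedBy K.K T₁.H` can be discharged by a tower-built `eH`; by `D2Bridge/Thm418CTransportFixed` the frame needs no more.  This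
file restates the two heads with the weak law (`_fixed` names); everything else verbatim.  Kernel only.
-/

set_option autoImplicit false

noncomputable section

namespace Summit.HodgeConjecture.CorCM.D2Bridge

open HodgeCM HodgeCM.Model NumberField NumberField.ComplexEmbedding
open HodgeCM.Literature.Theta HodgeCM.Literature.Theta.LiuAlbaneseModuleDatum
open HodgeCM.Literature.Theta.LiuAlbaneseModuleDatum.D2Bridge
open Literature.AlgebraicGeometry.HodgeTheory Literature.NumberTheory.Automorphic.PicardCM
open Literature.NumberTheory.Transcendental (Arapura2012_Cor_15_4_6)

variable {L : HodgeCM.CMField} {ι₀ ι₁ : (L : Type) →+* ℂ}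

/-- **S-d AT THE CONJUGATE-TRANSPOSED PIN, structural legs discharged, `res`-law on fixed vectors only.**  As
`thm418C_transposeAt_iff_of_transport` (wb-10) with `hres` required only for `x ∈ fixedBy K.K T₁.H`. [folklore] -/
theorem thm418C_transposeAt_iff_of_transport_fixed
    {hHD : exists_isReal_hodgeModel} {hI : hodgePQ_independent_of_hodgeModel}
    {h₁ : BallQuotientUniformised} {h₃ : CMAbelianVarietyRealised}
    (V : HodgeCM.HermSpace3 L ι₁) (ι₀ : (L : Type) →+* ℂ) (h : conjugate ι₀ = ι₁)
    (T₁ : LiuDictionary hHD hI h₁ h₃ V) (T₂ : LiuDictionary hHD hI h₁ h₃ (V.transposeAt ι₀ h))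
    (eC : T₁.Char ≃ T₂.Char) (eH : T₁.H ≃ₗ[ℂ] T₂.H)
    (heH : ∀ (g : ↥V.adelicFin) (x : T₁.H),
      eH (MonoidAlgebra.of ℂ ↥V.adelicFin g • x) = MonoidAlgebra.of ℂ ↥(V.transposeAt ι₀ h).adelicFin (adelicFinConj V ι₀ h g) • eH x)
    (hPhi : ∀ μ : T₁.Char, T₁.PhiMu μ ↔ T₂.PhiMu (eC μ))
    (hblock : ∀ μ : T₁.Char, (T₁.block μ).map (eH : T₁.H →ₗ[ℂ] T₂.H) = T₂.block (eC μ))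
    (hres : ∀ (K : HodgeCM.Level V) (x : T₁.H), x ∈ fixedBy K.K T₁.H →
      cohCCast (picardCMUniverse hHD hI h₁ h₃) (pms_levelConjAlong hHD hI h₁ h₃ V K ι₀ h).symm 1 (T₁.res K x) =
        T₂.res (levelConjAlong K ι₀ h) (eH x))
    (hcm : ∀ (K : HodgeCM.Level V) (μ : T₁.Char),
      T₂.cmClasses (levelConjAlong K ι₀ h) (eC μ) =
        cohCCast (picardCMUniverse hHD hI h₁ h₃) (pms_levelConjAlong hHD hI h₁ h₃ V K ι₀ h).symm 1 '' T₁.cmClasses K μ) :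
    T₁.Thm418C ↔ T₂.Thm418C :=
  thm418C_iff_of_transport_fixed T₁ T₂ (adelicFinConj V ι₀ h).toMulEquiv (levelConjEquiv V ι₀ h) eC eH
    (fun K => cohCCast (picardCMUniverse hHD hI h₁ h₃) (pms_levelConjAlong hHD hI h₁ h₃ V K ι₀ h).symm 1)
    (fun _ => rfl) heH hPhi hblock hres hcm

/-- **S-d AT THE PINNED DICTIONARIES, record side discharged, `res`-law on fixed vectors only.**  As
`thm418C_pin_transposeAt_iff_of_transport` (wb-10) with `hres` required only for `x ∈ fixedBy K.K _`. [folklore] -/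
theorem thm418C_pin_transposeAt_iff_of_transport_fixed
    (hHD : exists_isReal_hodgeModel) (hI : hodgePQ_independent_of_hodgeModel)
    (h₁ : BallQuotientUniformised) (h₃ : CMAbelianVarietyRealised) (hA : Arapura2012_Cor_15_4_6)
    (V : HodgeCM.HermSpace3 L ι₁) (ι₀ : (L : Type) →+* ℂ) (h : conjugate ι₀ = ι₁)
    {I Ī : Type} (line : I → SplitLineE V) (linē : Ī → SplitLineE (V.transposeAt ι₀ h)) (eC : I ≃ Ī)
    (hline : ∀ i, (linē (eC i)).lineType = HodgeCM.CMTypeOps.bar (line i).lineType)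
    (eH : (liuDictionaryPin hHD hI h₁ h₃ hA V I line).H ≃ₗ[ℂ] (liuDictionaryPin hHD hI h₁ h₃ hA (V.transposeAt ι₀ h) Ī linē).H)
    (heH : ∀ (g : ↥V.adelicFin) (x : (liuDictionaryPin hHD hI h₁ h₃ hA V I line).H),
      eH (MonoidAlgebra.of ℂ ↥V.adelicFin g • x) = MonoidAlgebra.of ℂ ↥(V.transposeAt ι₀ h).adelicFin (adelicFinConj V ι₀ h g) • eH x)
    (hblock : ∀ i : I, ((liuDictionaryPin hHD hI h₁ h₃ hA V I line).block i).map
        (eH : (liuDictionaryPin hHD hI h₁ h₃ hA V I line).H →ₗ[ℂ] (liuDictionaryPin hHD hI h₁ h₃ hA (V.transposeAt ι₀ h) Ī linē).H) =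
      (liuDictionaryPin hHD hI h₁ h₃ hA (V.transposeAt ι₀ h) Ī linē).block (eC i))
    (hres : ∀ (K : HodgeCM.Level V) (x : (liuDictionaryPin hHD hI h₁ h₃ hA V I line).H),
      x ∈ fixedBy K.K (liuDictionaryPin hHD hI h₁ h₃ hA V I line).H →
      cohCCast (picardCMUniverse hHD hI h₁ h₃) (pms_levelConjAlong hHD hI h₁ h₃ V K ι₀ h).symm 1
          ((liuDictionaryPin hHD hI h₁ h₃ hA V I line).res K x) =
        (liuDictionaryPin hHD hI h₁ h₃ hA (V.transposeAt ι₀ h) Ī linē).res (levelConjAlong K ι₀ h) (eH x)) :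
    (liuDictionaryPin hHD hI h₁ h₃ hA V I line).Thm418C ↔ (liuDictionaryPin hHD hI h₁ h₃ hA (V.transposeAt ι₀ h) Ī linē).Thm418C :=
  thm418C_transposeAt_iff_of_transport_fixed V ι₀ h _ _ eC eH heH
    (phiMu_pin_transposeAt_iff hHD hI h₁ h₃ hA V ι₀ h line linē eC hline) hblock hres
    (cmClasses_pin_transposeAt_eq hHD hI h₁ h₃ hA V ι₀ h line linē eC hline)

end Summit.HodgeConjecture.CorCM.D2Bridge

end
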